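import Literature.AlgebraicGeometry.HodgeTheory.SerreTheoremALineBundlesProofs
import Literature.Algebra.Homology.NatCochainFlagCount
import HarnessLib

/-!
# Serre's dimension count for line cocycles in dimension `n`: the flag tower of a Leray datum

Layer `Literature/AlgebraicGeometry/HodgeTheory`. The `n`-ary form of the dimension count of
`SerreTheoremALineBundlesProofs` (J.-P. Serre, *Géométrie algébrique et géométrie analytique* (1956),
n° 16 Lemme 8; *Faisceaux algébriques cohérents* (1955), n° 66 and n° 81; D. Mumford, *Abelian
Varieties* (1970), §16: induction over `n` hyperplane sections in general position), for the tower
`L_m = L ⊗ 𝒪_X(mH)^an` (`CartierTwistTower.twistBundle`) of a cocycle line bundle `L` on an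
analytification `φ : M → X(ℂ)` of an integral scheme `X` and `N` algebraic sections `s₀, …, s_{N-1}`
of `𝒪_X(H)`:

* `SerreTheoremAFlag.cov m` — the level-`0` cover `𝔙` of nested Leray data subordinate to the
  trivialisation of `L_0` as ONE framed cover of every `L_m`; `mulT j m` — multiplication by the
  coordinates `u_j = (f_a s_j) ∘ φ` of `s_j` on the Čech cochains `C•(𝔙, 𝒪(L_m)) → C•(𝔙, 𝒪(L_{m+1}))`
  (cochain maps, pairwise commuting, injective when `{u_j ≠ 0}` is dense);
* `SerreTheoremAFlag.zset` — the common zero set `Z` of the coordinates (frame-independent,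
  `mem_zset_iff`), restriction `toZ` to the skyscraper complexes `C•(𝔙, L_{m+1}|_Z)` kills the
  `u_j`-multiples (`toZ_mulT`), is surjective for finite `Z` (interpolation on the chart-convex
  members, `toZ_surjective`), with kernel `Σ_j u_j C•(𝔙, 𝒪(L_m))` granted the MEMBERWISE
  Nullstellensatz `hDv` (`ker_toZ`);
* `SerreTheoremAFlag.flagTower` — granted in addition the memberwise regular-sequence property `hreg`
  of `u_0, …, u_{N-1}` on the members, the Čech complexes form a flag tower
  (`Literature.Algebra.Homology.NatCochain.FlagTower`), whence — the Cartan–Serre finiteness of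
  `Ȟ^q(𝔙, 𝒪(L_m))` in all degrees (`DolbeaultLerayDatum.finiteDimensional_cohomologyL`) and
  `Ȟ^{≥1}(Z) = 0 ≠ Ȟ⁰(Z)` for the skyscraper being theorems of the tree —
  `exists_finrank_cohomology_zero_pos` (`Ȟ⁰(𝔙, 𝒪(L_m)) ≠ 0` for some `m ≥ 1`) and
  `exists_globalSection`: **some positive twist `L ⊗ 𝒪_X(mH)^an` has a holomorphic section which is
  not identically zero**.

The memberwise hypotheses `hreg`, `hDv` are exactly the fields `regular`, `ker_ev` of the flag tower
read on the members `V_J` in the frame of `J 0`; they are discharged on the Leray data of a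
STRAIGHTENED atlas (members convex in charts in which the `u_j` are linear coordinates,
`Literature.Geometry.Kaehler.exists_eq_sum_mul_of_mul_eq_sum_mul`,
`Literature.Geometry.Kaehler.exists_eq_sum_mul_of_forall_eq_zero`) by the consumer, the proof of the
Kodaira–Serre sections `kodairaSerre_exists_globalSection_algebraicTwist` in all dimensions. The case
`N = 2` with the hypotheses discharged in dimension `2` is `serre_theoremA_lineCocycle_surface_holds`.
Everything here is proved; the definitions are `cov`, `mulT`, `zset`, `flagTower`.

## References

* J.-P. Serre, *Géométrie algébrique et géométrie analytique*, Ann. Inst. Fourier 6 (1956), n° 16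
  Lemme 8. [SerreGAGA1956]
* J.-P. Serre, *Faisceaux algébriques cohérents*, Ann. of Math. 61 (1955), n° 66, n° 81.
  [SerreFAC1955]
* D. Mumford, *Abelian Varieties* (1970), §16. [MumfordAV1970]
-/

noncomputable section

open scoped Manifold ContDiff Topology
open CategoryTheory AlgebraicGeometry TopologicalSpace Set Function
open Literature.AlgebraicGeometry.Motives
open Literature.AlgebraicGeometry.Motives.RatFn
open Literature.AlgebraicGeometry.Motives.AlgPoints
open Literature.NumberTheory.Transcendental
open Literature.Geometry.Kaehler
open Literature.Geometry.Kaehler.HolomorphicLineBundle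
open Literature.Algebra.Homology

namespace Literature.AlgebraicGeometry.HodgeTheory

/-! ### Linear algebra: the span of finitely many ranges is the range of the sum map -/

section BiSup

variable {V W : Type*} [AddCommGroup V] [Module ℂ V] [AddCommGroup W] [Module ℂ W] {N : ℕ}

/-- **Membership in `Σ_{j<i} im T_j`**: `w ∈ ⨆_{j<i} range (T j)` iff `w = Σ_{j<i} T_j v_j` for some
`v` (the span of finitely many ranges is the range of the sum map; the format of the flag submodules of
`NatCochain.FlagTower`). [folklore] -/
theorem mem_biSup_range_iff (T : Fin N → V →ₗ[ℂ] W) (i : ℕ) (w : W) :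
    w ∈ (⨆ (j : Fin N) (_ : (j : ℕ) < i), LinearMap.range (T j)) ↔
      ∃ v : Fin N → V,
        ∑ j ∈ (Finset.univ : Finset (Fin N)).filter (fun j : Fin N ↦ (j : ℕ) < i), T j (v j) = w := by
  classical
  set S : (Fin N → V) →ₗ[ℂ] W :=
    ∑ j ∈ (Finset.univ : Finset (Fin N)).filter (fun j : Fin N ↦ (j : ℕ) < i), T j ∘ₗ LinearMap.proj j
    with hS
  have hS_apply : ∀ v, S v =
      ∑ j ∈ (Finset.univ : Finset (Fin N)).filter (fun j : Fin N ↦ (j : ℕ) < i), T j (v j) := fun v ↦ by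
    simp [hS]
  constructor
  · intro hw
    have hle : (⨆ (j : Fin N) (_ : (j : ℕ) < i), LinearMap.range (T j)) ≤ LinearMap.range S := by
      refine iSup₂_le fun j hj ↦ ?_
      rintro _ ⟨y, rfl⟩
      refine ⟨Pi.single j y, ?_⟩
      rw [hS_apply, Finset.sum_eq_single j]
      · rw [Pi.single_eq_same]
      · intro j' _ hj'
        rw [Pi.single_eq_of_ne hj', map_zero]
      · intro hj'
        exact (hj' (Finset.mem_filter.2 ⟨Finset.mem_univ j, hj⟩)).elim
    obtain ⟨v, hv⟩ := hle hw
    exact ⟨v, by rw [← hS_apply]; exact hv⟩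
  · rintro ⟨v, rfl⟩
    exact Submodule.sum_mem _ fun j hj ↦
      Submodule.mem_iSup_of_mem j (Submodule.mem_iSup_of_mem (Finset.mem_filter.1 hj).2 ⟨v j, rfl⟩)

/-- **Membership in `Σ_j im T_j`**: `w ∈ ⨆_j range (T j)` iff `w = Σ_j T_j v_j` for some `v`.
[folklore] -/
theorem mem_iSup_range_iff (T : Fin N → V →ₗ[ℂ] W) (w : W) :
    w ∈ (⨆ j : Fin N, LinearMap.range (T j)) ↔ ∃ v : Fin N → V, ∑ j, T j (v j) = w := by
  have h := mem_biSup_range_iff T N w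
  have e1 : (⨆ (j : Fin N) (_ : (j : ℕ) < N), LinearMap.range (T j)) = ⨆ j : Fin N, LinearMap.range (T j) :=
    iSup_congr fun j ↦ iSup_pos j.is_lt
  have e2 : (Finset.univ : Finset (Fin N)).filter (fun j : Fin N ↦ (j : ℕ) < N) = Finset.univ :=
    Finset.filter_true_of_mem fun j _ ↦ j.is_lt
  rw [e1, e2] at h
  exact h

end BiSup

namespace SerreTheoremAFlag

open SerreTheoremASurface (cov cov_subset hfr_twist pt_mem_of_mem_cechSet sectionCoord_eq_zero_iff holCut
  holCut_apply_of_mem finiteDimensional_cohC)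

variable {X : SchemeOver ℂ} [IsIntegral X.left] {n : ℕ}
  {E : Type} [NormedAddCommGroup E] [NormedSpace ℂ E] [FiniteDimensional ℂ E]
  {M : Type} [TopologicalSpace M] [ChartedSpace E M]
  {φ : M → ComplexPoints X} (hφ : IsAnalytification E X n φ)
  (H : CartierDivisor X.left) {ι : Type} (L : HolomorphicLineBundle ι E M)
  {N : ℕ} {s : Fin N → X.left.functionField} (hs : ∀ j, H.IsSection (s j))
  (D : DolbeaultLerayDatum E M) (fr : ↥D.s → ι × H.ι)
  (hfr : ∀ i, D.U 3 i ⊆ (twistBundle hφ H L 0).baseSet (fr i))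

/-! ### Multiplication by the sections on cochains -/

/-- **Multiplication by `u_j` (the coordinates of `s_j`)**: `C^a(𝔙, 𝒪(L_m)) → C^a(𝔙, 𝒪(L_{m+1}))`.
[cite: SerreGAGA1956, n°16 Lemme 8 (proof)] -/
def mulT (j : Fin N) (m a : ℕ) : (cov hφ H L D fr hfr m).Cochain a →ₗ[ℂ] (cov hφ H L D fr hfr (m + 1)).Cochain a :=
  (cov hφ H L D fr hfr m).mulCochain (homSectionOfIsSection hφ H L (hs j) m) (cov_subset hφ H L D fr hfr m (m + 1)) a

/-- `mulT` is a cochain map. [cite: SerreFAC1955, n° 81] -/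
theorem mulT_comm (j : Fin N) (m a : ℕ) (c : (cov hφ H L D fr hfr m).Cochain a) :
    mulT hφ H L hs D fr hfr j m (a + 1) ((cov hφ H L D fr hfr m).delta a c) =
      (cov hφ H L D fr hfr (m + 1)).delta a (mulT hφ H L hs D fr hfr j m a c) :=
  ((cov hφ H L D fr hfr m).delta_mulCochain (homSectionOfIsSection hφ H L (hs j) m)
    (cov_subset hφ H L D fr hfr m (m + 1)) a c).symm

/-- `mulT` at a point of `V_J`. [folklore] -/
theorem mulT_apply_apply_of_mem (j : Fin N) (m : ℕ) {a : ℕ} (c : (cov hφ H L D fr hfr m).Cochain a)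
    {J : Fin (a + 1) → ↥D.s} {x : M} (hx : x ∈ cechSet (D.U 0) J) :
    (mulT hφ H L hs D fr hfr j m a c J : M → ℂ) x =
      H.sectionCoord φ (hs j) (fr (J 0)).2 x * (c J : M → ℂ) x :=
  (cov hφ H L D fr hfr m).mulCochain_apply_apply_of_mem _ _ c hx

/-- **`mulT` is injective** when `{u_j ≠ 0}` is dense. [cite: SerreGAGA1956, n°7 Prop. 5] -/
theorem mulT_injective {j : Fin N}
    (hdense : Dense {x : M | ∀ a : H.ι, (φ x).pt ∈ H.U a → H.sectionCoord φ (hs j) a x ≠ 0})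
    (m a : ℕ) : Injective (mulT hφ H L hs D fr hfr j m a) :=
  (cov hφ H L D fr hfr m).mulCochain_injective _ _ fun J ↦
    cechSet_subset_closure_coord_ne_zero hφ H L (hs j) (cov hφ H L D fr hfr m) hdense J

/-- **The multiplications commute**: `u_i (u_j c) = u_j (u_i c)`. [cite: SerreGAGA1956, n°16 Lemme 8 (proof)] -/
theorem mulT_mulT_comm (i j : Fin N) (m a : ℕ) (c : (cov hφ H L D fr hfr m).Cochain a) :
    mulT hφ H L hs D fr hfr i (m + 1) a (mulT hφ H L hs D fr hfr j m a c) =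
      mulT hφ H L hs D fr hfr j (m + 1) a (mulT hφ H L hs D fr hfr i m a c) :=
  (cov hφ H L D fr hfr m).mulCochain_mulCochain_comm (homSectionOfIsSection hφ H L (hs j) m)
    (homSectionOfIsSection hφ H L (hs i) (m + 1)) (homSectionOfIsSection hφ H L (hs i) m)
    (homSectionOfIsSection hφ H L (hs j) (m + 1)) _ _ _ (fun _ _ _ ↦ mul_comm _ _) a c

/-- A sum of `u_j`-multiples at a point of `V_J`. [folklore] -/
theorem sum_mulT_apply_apply_of_mem (m : ℕ) {a : ℕ} (T : Finset (Fin N))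
    (v : Fin N → (cov hφ H L D fr hfr m).Cochain a) {J : Fin (a + 1) → ↥D.s} {x : M}
    (hx : x ∈ cechSet (D.U 0) J) :
    ((∑ j ∈ T, mulT hφ H L hs D fr hfr j m a (v j)) J : M → ℂ) x =
      ∑ j ∈ T, H.sectionCoord φ (hs j) (fr (J 0)).2 x * (v j J : M → ℂ) x := by
  rw [Finset.sum_apply, Submodule.coe_sum, Finset.sum_apply]
  exact Finset.sum_congr rfl fun j _ ↦ mulT_apply_apply_of_mem hφ H L hs D fr hfr j m (v j) hx

/-! ### The common zero set `Z` of the sections -/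

/-- **`Z = {s₀ = ⋯ = s_{N-1} = 0}` read on `M`**: the points at which all section coordinates vanish
in some (equivalently every, `mem_zset_iff`) frame. [cite: SerreGAGA1956, n°16 Lemme 8 (proof)] -/
def zset : Set M :=
  {x | ∃ a : H.ι, (φ x).pt ∈ H.U a ∧ ∀ j, H.sectionCoord φ (hs j) a x = 0}

omit [TopologicalSpace M] in
/-- Membership in `Z` read in any frame at hand. [folklore] -/
theorem mem_zset_iff {p : H.ι} {x : M} (hp : (φ x).pt ∈ H.U p) :
    x ∈ zset (φ := φ) H hs ↔ ∀ j, H.sectionCoord φ (hs j) p x = 0 := by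
  constructor
  · rintro ⟨a, ha, h0⟩ j
    exact (sectionCoord_eq_zero_iff H (hs j) ha hp).1 (h0 j)
  · intro h0
    exact ⟨p, hp, h0⟩

include hφ L hfr in
/-- On `Z ∩ V_J` every coordinate `u_j` in the frame of `J 0` vanishes. [folklore] -/
theorem sectionCoord_eq_zero_of_mem {a : ℕ} {J : Fin (a + 1) → ↥D.s} {x : M} (hx : x ∈ cechSet (D.U 0) J)
    (hz : x ∈ zset (φ := φ) H hs) (j : Fin N) : H.sectionCoord φ (hs j) (fr (J 0)).2 x = 0 :=
  (mem_zset_iff H hs (pt_mem_of_mem_cechSet hφ H L D fr hfr hx)).1 hz j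

/-! ### The skyscraper complexes and restriction to `Z` -/

/-- **The skyscraper complex `C•(𝔙, L_m|_Z)`.** [cite: SerreFAC1955, n° 81] -/
abbrev S (m a : ℕ) : Type := (cov hφ H L D fr hfr m).ZCochain (zset (φ := φ) H hs) a

/-- The differential of the skyscraper complex. [folklore] -/
abbrev dS (m a : ℕ) : S hφ H L hs D fr hfr m a →ₗ[ℂ] S hφ H L hs D fr hfr m (a + 1) :=
  (cov hφ H L D fr hfr m).zdelta (zset (φ := φ) H hs) a

/-- **Restriction to `Z`**, `C•(𝔙, 𝒪(L_{m+1})) → C•(𝔙, L_{m+1}|_Z)`. [cite: SerreFAC1955, n° 81] -/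
abbrev toZ (m a : ℕ) : (cov hφ H L D fr hfr (m + 1)).Cochain a →ₗ[ℂ] S hφ H L hs D fr hfr (m + 1) a :=
  (cov hφ H L D fr hfr (m + 1)).toZ (zset (φ := φ) H hs) a

/-- Restriction to `Z` kills the `u_j`-multiples (`u_j` vanishes on `Z`). [cite: SerreGAGA1956, n°16 Lemme 8 (proof)] -/
theorem toZ_mulT (j : Fin N) (m a : ℕ) (c : (cov hφ H L D fr hfr m).Cochain a) :
    toZ hφ H L hs D fr hfr m a (mulT hφ H L hs D fr hfr j m a c) = 0 := by
  refine funext fun J ↦ Subtype.ext (funext fun x ↦ ?_)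
  by_cases hx : x ∈ zset (φ := φ) H hs ∩ cechSet (D.U 0) J
  · rw [FramedCover.toZ_apply_apply_of_mem _ _ _ hx, mulT_apply_apply_of_mem hφ H L hs D fr hfr j m c hx.2,
      sectionCoord_eq_zero_of_mem hφ H L hs D fr hfr hx.2 hx.1 j, zero_mul]
    rfl
  · rw [FramedCover.toZ_apply_apply_of_notMem _ _ _ hx]
    rfl

/-- **Restriction to the finite set `Z` is surjective** (interpolation on the chart-convex members
`V_J`, `HolomorphicInterpolation`). [cite: SerreGAGA1956, n°16 Lemme 8 (proof)] -/
theorem toZ_surjective [IsManifold 𝓘(ℂ, E) ω M] (hZ : (zset (φ := φ) H hs).Finite) (m a : ℕ) :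
    Surjective (toZ hφ H L hs D fr hfr m a) := by
  classical
  intro w
  have key : ∀ J : Fin (a + 1) → ↥D.s, ∃ b : holFunOn E (cechSet (D.U 0) J),
      ∀ x ∈ zset (φ := φ) H hs ∩ cechSet (D.U 0) J, (b : M → ℂ) x = (w J : M → ℂ) x := by
    intro J
    set F := (hZ.inter_of_left (cechSet (D.U 0) J)).toFinset with hF
    have hFW : ∀ z ∈ F, z ∈ chartSet 𝓘(ℝ, E) (D.ctr a J) (D.C a J 0) := fun z hz ↦ by
      rw [← D.cechSet_eq a J 0]
      exact ((Set.Finite.mem_toFinset _).1 hz).2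
    obtain ⟨f, hf, hfv⟩ := exists_mdifferentiableOn_chartSet_forall_eq (D.ctr a J) F hFW (w J : M → ℂ)
    rw [← D.cechSet_eq a J 0] at hf
    exact ⟨holCut f hf, fun x hx ↦ (holCut_apply_of_mem f hf hx.2).trans
      (hfv x ((Set.Finite.mem_toFinset _).2 hx))⟩
  choose b hb using key
  refine ⟨b, ?_⟩
  refine funext fun J ↦ Subtype.ext (funext fun x ↦ ?_)
  by_cases hx : x ∈ zset (φ := φ) H hs ∩ cechSet (D.U 0) J
  · rw [FramedCover.toZ_apply_apply_of_mem _ _ _ hx]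
    exact hb J x hx
  · rw [FramedCover.toZ_apply_apply_of_notMem _ _ _ hx]
    exact ((w J).2 x hx).symm

/-- **`ker (C•(L_{m+1}) → C•(L_{m+1}|_Z)) = Σ_j u_j C•(L_m)`**, granted the memberwise Nullstellensatz
`hDv` (a holomorphic function on `V_J` vanishing on `Z ∩ V_J` lies in `(u_0, …, u_{N-1}) 𝒪(V_J)`) and
the vanishing of the `u_j` on `Z`. [cite: SerreGAGA1956, n°16 Lemme 8 (proof)] -/
theorem ker_toZ
    (hDv : ∀ (a : ℕ) (J : Fin (a + 1) → ↥D.s) (f : holFunOn E (cechSet (D.U 0) J)),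
      (∀ x ∈ zset (φ := φ) H hs ∩ cechSet (D.U 0) J, (f : M → ℂ) x = 0) →
        ∃ g : Fin N → holFunOn E (cechSet (D.U 0) J), ∀ x ∈ cechSet (D.U 0) J,
          (f : M → ℂ) x = ∑ j, H.sectionCoord φ (hs j) (fr (J 0)).2 x * (g j : M → ℂ) x)
    (m a : ℕ) :
    LinearMap.ker (toZ hφ H L hs D fr hfr m a) = ⨆ j : Fin N, LinearMap.range (mulT hφ H L hs D fr hfr j m a) := by
  refine le_antisymm ?_ (iSup_le fun j ↦ ?_)
  · intro c hc
    rw [LinearMap.mem_ker] at hc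
    have key : ∀ J : Fin (a + 1) → ↥D.s, ∃ g : Fin N → holFunOn E (cechSet (D.U 0) J),
        ∀ x ∈ cechSet (D.U 0) J,
          (c J : M → ℂ) x = ∑ j, H.sectionCoord φ (hs j) (fr (J 0)).2 x * (g j : M → ℂ) x := fun J ↦
      hDv a J (c J) fun x hx ↦ by
        have h1 := congrArg (fun f : S hφ H L hs D fr hfr (m + 1) a ↦ (f J : M → ℂ) x) hc
        simp only [Pi.zero_apply, ZeroMemClass.coe_zero] at h1
        rwa [FramedCover.toZ_apply_apply_of_mem _ _ _ hx] at h1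
    choose g hg using key
    rw [mem_iSup_range_iff]
    refine ⟨fun j J ↦ g J j, funext fun J ↦ Subtype.ext (funext fun x ↦ ?_)⟩
    by_cases hx : x ∈ cechSet (D.U 0) J
    · rw [sum_mulT_apply_apply_of_mem hφ H L hs D fr hfr m Finset.univ _ hx, hg J x hx]
    · rw [holFunOn.apply_of_notMem _ hx, holFunOn.apply_of_notMem _ hx]
  · rintro _ ⟨c, rfl⟩
    exact (LinearMap.mem_ker).2 (toZ_mulT hφ H L hs D fr hfr j m a c)

/-- **Regularity: `u_i` is a non-zero-divisor modulo `(u_0, …, u_{i-1})` on cochains**, granted the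
memberwise regular-sequence property `hreg` on the members `V_J`.
[cite: SerreGAGA1956, n°16 Lemme 8 (proof)] [cite: SerreFAC1955, n° 81] -/
theorem regular_mulT
    (hreg : ∀ (i : Fin N) (a : ℕ) (J : Fin (a + 1) → ↥D.s) (f : holFunOn E (cechSet (D.U 0) J))
      (g : Fin N → holFunOn E (cechSet (D.U 0) J)),
      (∀ x ∈ cechSet (D.U 0) J, H.sectionCoord φ (hs i) (fr (J 0)).2 x * (f : M → ℂ) x =
        ∑ j ∈ (Finset.univ : Finset (Fin N)).filter (fun j : Fin N ↦ (j : ℕ) < (i : ℕ)),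
          H.sectionCoord φ (hs j) (fr (J 0)).2 x * (g j : M → ℂ) x) →
      ∃ h : Fin N → holFunOn E (cechSet (D.U 0) J), ∀ x ∈ cechSet (D.U 0) J,
        (f : M → ℂ) x = ∑ j ∈ (Finset.univ : Finset (Fin N)).filter (fun j : Fin N ↦ (j : ℕ) < (i : ℕ)),
          H.sectionCoord φ (hs j) (fr (J 0)).2 x * (h j : M → ℂ) x)
    (i : Fin N) (m a : ℕ) (c : (cov hφ H L D fr hfr (m + 1)).Cochain a)
    (hc : mulT hφ H L hs D fr hfr i (m + 1) a c ∈
      ⨆ (j : Fin N) (_ : (j : ℕ) < (i : ℕ)), LinearMap.range (mulT hφ H L hs D fr hfr j (m + 1) a)) :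
    c ∈ ⨆ (j : Fin N) (_ : (j : ℕ) < (i : ℕ)), LinearMap.range (mulT hφ H L hs D fr hfr j m a) := by
  obtain ⟨v, hv⟩ := (mem_biSup_range_iff _ _ _).1 hc
  have key : ∀ J : Fin (a + 1) → ↥D.s, ∃ h : Fin N → holFunOn E (cechSet (D.U 0) J),
      ∀ x ∈ cechSet (D.U 0) J,
        (c J : M → ℂ) x = ∑ j ∈ (Finset.univ : Finset (Fin N)).filter (fun j : Fin N ↦ (j : ℕ) < (i : ℕ)),
          H.sectionCoord φ (hs j) (fr (J 0)).2 x * (h j : M → ℂ) x := fun J ↦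
    hreg i a J (c J) (fun j ↦ v j J) fun x hx ↦ by
      have h1 := congrArg (fun f : (cov hφ H L D fr hfr (m + 2)).Cochain a ↦ (f J : M → ℂ) x) hv
      simp only at h1
      rw [sum_mulT_apply_apply_of_mem hφ H L hs D fr hfr (m + 1) _ _ hx,
        mulT_apply_apply_of_mem hφ H L hs D fr hfr i (m + 1) c hx] at h1
      exact h1.symm
  choose h hh using key
  rw [mem_biSup_range_iff]
  refine ⟨fun j J ↦ h J j, funext fun J ↦ Subtype.ext (funext fun x ↦ ?_)⟩
  by_cases hx : x ∈ cechSet (D.U 0) J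
  · rw [sum_mulT_apply_apply_of_mem hφ H L hs D fr hfr m _ _ hx, hh J x hx]
  · rw [holFunOn.apply_of_notMem _ hx, holFunOn.apply_of_notMem _ hx]

/-! ### The flag tower of the Čech complexes -/

/-- **The Čech complexes `C•(𝔙, 𝒪(L_m))` with the multiplications `u_j` and the restriction to `Z`
form a flag tower** (`NatCochain.FlagTower N`), granted the density of `{u_j ≠ 0}`, the memberwise
regular-sequence and Nullstellensatz properties, and the finiteness of `Z`.
[cite: SerreGAGA1956, n°16 Lemme 8] [cite: SerreFAC1955, n° 81] -/
def flagTower [IsManifold 𝓘(ℂ, E) ω M]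
    (hreg : ∀ (i : Fin N) (a : ℕ) (J : Fin (a + 1) → ↥D.s) (f : holFunOn E (cechSet (D.U 0) J))
      (g : Fin N → holFunOn E (cechSet (D.U 0) J)),
      (∀ x ∈ cechSet (D.U 0) J, H.sectionCoord φ (hs i) (fr (J 0)).2 x * (f : M → ℂ) x =
        ∑ j ∈ (Finset.univ : Finset (Fin N)).filter (fun j : Fin N ↦ (j : ℕ) < (i : ℕ)),
          H.sectionCoord φ (hs j) (fr (J 0)).2 x * (g j : M → ℂ) x) →
      ∃ h : Fin N → holFunOn E (cechSet (D.U 0) J), ∀ x ∈ cechSet (D.U 0) J,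
        (f : M → ℂ) x = ∑ j ∈ (Finset.univ : Finset (Fin N)).filter (fun j : Fin N ↦ (j : ℕ) < (i : ℕ)),
          H.sectionCoord φ (hs j) (fr (J 0)).2 x * (h j : M → ℂ) x)
    (hDv : ∀ (a : ℕ) (J : Fin (a + 1) → ↥D.s) (f : holFunOn E (cechSet (D.U 0) J)),
      (∀ x ∈ zset (φ := φ) H hs ∩ cechSet (D.U 0) J, (f : M → ℂ) x = 0) →
        ∃ g : Fin N → holFunOn E (cechSet (D.U 0) J), ∀ x ∈ cechSet (D.U 0) J,
          (f : M → ℂ) x = ∑ j, H.sectionCoord φ (hs j) (fr (J 0)).2 x * (g j : M → ℂ) x)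
    (hZ : (zset (φ := φ) H hs).Finite) :
    NatCochain.FlagTower (K := ℂ) N (fun m a ↦ (cov hφ H L D fr hfr m).delta a)
      (fun m a ↦ dS hφ H L hs D fr hfr (m + 1) a) where
  t j m a := mulT hφ H L hs D fr hfr j m a
  ev m a := toZ hφ H L hs D fr hfr m a
  d_d m a x := (cov hφ H L D fr hfr m).delta_delta a x
  comm_t j m a x := mulT_comm hφ H L hs D fr hfr j m a x
  t_comm i j m a x := mulT_mulT_comm hφ H L hs D fr hfr i j m a x
  regular i m a x hx := regular_mulT hφ H L hs D fr hfr hreg i m a x hx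
  comm_ev m a x := (cov hφ H L D fr hfr (m + 1)).toZ_delta (zset (φ := φ) H hs) a x
  surjective_ev m a := toZ_surjective hφ H L hs D fr hfr hZ m a
  ker_ev m a := ker_toZ hφ H L hs D fr hfr hDv m a

/-! ### Finiteness and the dimension count -/

/-- **`h^q(C•(𝔙, L_m|_Z)) < ∞`** (finite `Z`, finitely many members). [cite: SerreFAC1955, n° 81] -/
theorem finiteDimensional_cohS (hZ : (zset (φ := φ) H hs).Finite) (m q : ℕ) :
    FiniteDimensional ℂ (NatCochain.Cohomology (R := ℂ) (dS hφ H L hs D fr hfr m) q) :=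
  (cov hφ H L D fr hfr m).finiteDimensional_zcohomology (zset (φ := φ) H hs) hZ q

/-- **The base of the count: `h¹(Z) = 0 < 1 ≤ h⁰(Z)`** (`Z ≠ ∅` meets the covering `𝔙`).
[cite: SerreGAGA1956, n°16 Lemme 8 (dimension count)] -/
theorem finrank_cohS_one_lt (hZ : (zset (φ := φ) H hs).Finite) (hZne : (zset (φ := φ) H hs).Nonempty)
    (m : ℕ) :
    Module.finrank ℂ (NatCochain.Cohomology (R := ℂ) (dS hφ H L hs D fr hfr m) 1) <
      Module.finrank ℂ (NatCochain.Cohomology (R := ℂ) (dS hφ H L hs D fr hfr m) 0) := by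
  obtain ⟨z₀, hz₀⟩ := hZne
  obtain ⟨k₀, hk₀⟩ : ∃ k, z₀ ∈ D.U 0 k := mem_iUnion.1 (by rw [D.cover 0]; exact mem_univ z₀)
  haveI : Nonempty ↥D.s := ⟨k₀⟩
  haveI : Subsingleton (NatCochain.Cohomology (R := ℂ) (dS hφ H L hs D fr hfr m) 1) :=
    (cov hφ H L D fr hfr m).subsingleton_zcohomology_succ (zset (φ := φ) H hs) 0
  haveI : Nontrivial (NatCochain.Cohomology (R := ℂ) (dS hφ H L hs D fr hfr m) 0) :=
    (cov hφ H L D fr hfr m).nontrivial_zcohomology_zero hz₀ hk₀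
  haveI := finiteDimensional_cohS hφ H L hs D fr hfr hZ m 0
  have h0 : Module.finrank ℂ (NatCochain.Cohomology (R := ℂ) (dS hφ H L hs D fr hfr m) 1) = 0 :=
    Module.finrank_zero_of_subsingleton
  rw [h0]
  exact Module.finrank_pos

variable [T2Space M] [CompactSpace M] [IsManifold 𝓘(ℂ, E) ω M] [IsManifold 𝓘(ℝ, E) ∞ M]

/-- **Serre's dimension count for the tower in dimension `N`**: granted the density of each
`{u_j ≠ 0}`, the memberwise regular-sequence and Nullstellensatz properties of `u_0, …, u_{N-1}` on the
members of `𝔙` and `Z` finite non-empty, `h⁰(𝔙, 𝒪(L_m)) > 0` for some `m ≥ 1`.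
[cite: SerreGAGA1956, n°16 Lemme 8 (dimension count)] [cite: MumfordAV1970, §16] -/
theorem exists_finrank_cohomology_zero_pos
    (hreg : ∀ (i : Fin N) (a : ℕ) (J : Fin (a + 1) → ↥D.s) (f : holFunOn E (cechSet (D.U 0) J))
      (g : Fin N → holFunOn E (cechSet (D.U 0) J)),
      (∀ x ∈ cechSet (D.U 0) J, H.sectionCoord φ (hs i) (fr (J 0)).2 x * (f : M → ℂ) x =
        ∑ j ∈ (Finset.univ : Finset (Fin N)).filter (fun j : Fin N ↦ (j : ℕ) < (i : ℕ)),
          H.sectionCoord φ (hs j) (fr (J 0)).2 x * (g j : M → ℂ) x) →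
      ∃ h : Fin N → holFunOn E (cechSet (D.U 0) J), ∀ x ∈ cechSet (D.U 0) J,
        (f : M → ℂ) x = ∑ j ∈ (Finset.univ : Finset (Fin N)).filter (fun j : Fin N ↦ (j : ℕ) < (i : ℕ)),
          H.sectionCoord φ (hs j) (fr (J 0)).2 x * (h j : M → ℂ) x)
    (hDv : ∀ (a : ℕ) (J : Fin (a + 1) → ↥D.s) (f : holFunOn E (cechSet (D.U 0) J)),
      (∀ x ∈ zset (φ := φ) H hs ∩ cechSet (D.U 0) J, (f : M → ℂ) x = 0) →
        ∃ g : Fin N → holFunOn E (cechSet (D.U 0) J), ∀ x ∈ cechSet (D.U 0) J,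
          (f : M → ℂ) x = ∑ j, H.sectionCoord φ (hs j) (fr (J 0)).2 x * (g j : M → ℂ) x)
    (hZ : (zset (φ := φ) H hs).Finite) (hZne : (zset (φ := φ) H hs).Nonempty) :
    ∃ m, 0 < m ∧
      0 < Module.finrank ℂ (NatCochain.Cohomology (R := ℂ) (fun a ↦ (cov hφ H L D fr hfr m).delta a) 0) :=
  (flagTower hφ H L hs D fr hfr hreg hDv hZ).exists_pos_finrank_cohomology_zero
    (fun m q ↦ finiteDimensional_cohC hφ H L D fr hfr m q)
    (fun m ↦ finiteDimensional_cohS hφ H L hs D fr hfr hZ (m + 1) 0)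
    (fun m ↦ finiteDimensional_cohS hφ H L hs D fr hfr hZ (m + 1) 1)
    (fun m ↦ finrank_cohS_one_lt hφ H L hs D fr hfr hZ hZne (m + 1))

include hfr in
/-- **A non-zero holomorphic section of some positive twist `L ⊗ 𝒪_X(mH)^an`** (`dim Ȟ⁰ > 0`,
`FramedCover.finrank_cohomology_zero`, `exists_zeroSet_ne_univ_of_h0_pos`).
[cite: SerreGAGA1956, n°16 Lemme 8] -/
theorem exists_globalSection
    (hreg : ∀ (i : Fin N) (a : ℕ) (J : Fin (a + 1) → ↥D.s) (f : holFunOn E (cechSet (D.U 0) J))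
      (g : Fin N → holFunOn E (cechSet (D.U 0) J)),
      (∀ x ∈ cechSet (D.U 0) J, H.sectionCoord φ (hs i) (fr (J 0)).2 x * (f : M → ℂ) x =
        ∑ j ∈ (Finset.univ : Finset (Fin N)).filter (fun j : Fin N ↦ (j : ℕ) < (i : ℕ)),
          H.sectionCoord φ (hs j) (fr (J 0)).2 x * (g j : M → ℂ) x) →
      ∃ h : Fin N → holFunOn E (cechSet (D.U 0) J), ∀ x ∈ cechSet (D.U 0) J,
        (f : M → ℂ) x = ∑ j ∈ (Finset.univ : Finset (Fin N)).filter (fun j : Fin N ↦ (j : ℕ) < (i : ℕ)),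
          H.sectionCoord φ (hs j) (fr (J 0)).2 x * (h j : M → ℂ) x)
    (hDv : ∀ (a : ℕ) (J : Fin (a + 1) → ↥D.s) (f : holFunOn E (cechSet (D.U 0) J)),
      (∀ x ∈ zset (φ := φ) H hs ∩ cechSet (D.U 0) J, (f : M → ℂ) x = 0) →
        ∃ g : Fin N → holFunOn E (cechSet (D.U 0) J), ∀ x ∈ cechSet (D.U 0) J,
          (f : M → ℂ) x = ∑ j, H.sectionCoord φ (hs j) (fr (J 0)).2 x * (g j : M → ℂ) x)
    (hZ : (zset (φ := φ) H hs).Finite) (hZne : (zset (φ := φ) H hs).Nonempty) :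
    ∃ m, 0 < m ∧ ∃ σ : (twistBundle hφ H L m).GlobalSection, σ.zeroSet ≠ univ := by
  obtain ⟨m, hm0, hm⟩ := exists_finrank_cohomology_zero_pos hφ H L hs D fr hfr hreg hDv hZ hZne
  have hcov : ∀ x : M, ∃ k, x ∈ (cov hφ H L D fr hfr m).U k := fun x ↦
    mem_iUnion.1 (show x ∈ ⋃ i, D.U 0 i by rw [D.cover 0]; exact mem_univ x)
  have h := (cov hφ H L D fr hfr m).finrank_cohomology_zero hcov
  refine ⟨m, hm0, HolomorphicLineBundle.exists_zeroSet_ne_univ_of_h0_pos (L := twistBundle hφ H L m) ?_⟩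
  rw [← h]
  exact hm

end SerreTheoremAFlag

end Literature.AlgebraicGeometry.HodgeTheory

end
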